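import Mathlib
import Literature.AlgebraicGeometry.Resolution.CobordantBlowupFiltration
import HarnessLib

/-!
# The `t⁻¹`-saturation of a prime ideal in an extended Rees algebra is prime

Topic: `Literature/AlgebraicGeometry/Resolution`. For a filtration `F` of ideals of `A` with extended
Rees algebra `S = ⊕ₙ Jₙ tⁿ[t⁻¹] ⊆ A[t, t⁻¹]` (`IdealFiltration.extendedRees`,
`CobordantBlowupFiltration.lean`) and an ideal `𝔭 ⊆ A`, the `t⁻¹`-saturation
`⋃ₙ (𝔭 S : (t⁻¹)ⁿ)` — the chartwise strict transform of `V(𝔭)` under Włodarczyk's full cobordant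
blow-up (arXiv:2203.03090, 3.3.12: "`σˢ(I) = {tᵃ f | f ∈ 𝒪_B · I}`", the ideal of the schematic
closure of `V(I) × 𝔾ₘ ⊆ B₋ = X × 𝔾ₘ` in `B`) — consists of the elements of `S` all of whose Laurent
coefficients lie in `𝔭` (`mem_iSup_colon_iff_forall_coeff_mem`); hence it is the kernel of
`S → (A/𝔭)[t, t⁻¹]` and is PRIME when `𝔭` is (`isPrime_iSup_colon`): **the strict transform of an
integral closed subscheme is integral on every chart** (the algebra behind
"`X' ∖ D' ≃ (X ∖ V(𝒥)) × T`", Thm. 1.1.2 (4), and the birationality of the weighted algorithm; route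
`ResolutionOfSingularities/WeightedInvariant`, stmt-0572/8974). Folklore; PROVED; no definitions
(`t⁻¹ ∈ S` is written `⟨T (-1), F.T_neg_one_mem_extendedRees⟩`).
-/

noncomputable section

open scoped LaurentPolynomial
open LaurentPolynomial

namespace Literature.AlgebraicGeometry.Resolution

universe u

variable {A : Type u} [CommRing A] (F : IdealFiltration A) (𝔭 : Ideal A)

namespace IdealFiltration

/-- The element `s = t⁻¹` of the extended Rees algebra (local notation). -/
local notation3 "𝔰" =>
  (Subtype.mk (T (-1)) (IdealFiltration.T_neg_one_mem_extendedRees F) : IdealFiltration.extendedRees F)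

/-- Multiplying by `sⁿ` shifts the Laurent coefficients. [folklore] -/
theorem coeff_T_neg_one_pow_mul (x : F.extendedRees) (n : ℕ) (m : ℤ) :
    ((𝔰 ^ n * x : F.extendedRees) : A[T;T⁻¹]).coeff m = (x : A[T;T⁻¹]).coeff (m + n) := by
  rw [MulMemClass.coe_mul, SubmonoidClass.coe_pow]
  change ((T (-1) : A[T;T⁻¹]) ^ n * (x : A[T;T⁻¹])).coeff m = _
  rw [T_pow, show (T (n * (-1 : ℤ)) : A[T;T⁻¹]) = AddMonoidAlgebra.single (-(n : ℤ)) 1 by rw [T]; congr 1; ring,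
    AddMonoidAlgebra.coeff_single_mul_apply, one_mul]
  congr 1
  ring

/-- The elements of `𝔭 S` have all their Laurent coefficients in `𝔭`. [folklore] -/
theorem coeff_mem_of_mem_map {x : F.extendedRees} (hx : x ∈ 𝔭.map (algebraMap A F.extendedRees)) (m : ℤ) :
    (x : A[T;T⁻¹]).coeff m ∈ 𝔭 := by
  -- the reduction `S → (A/𝔭)[t, t⁻¹]` kills `𝔭 S`
  let ρ : F.extendedRees →+* (A ⧸ 𝔭)[T;T⁻¹] :=
    (AddMonoidAlgebra.mapRingHom ℤ (Ideal.Quotient.mk 𝔭)).comp F.extendedRees.val.toRingHom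
  have hρ : ∀ (y : F.extendedRees) (m : ℤ), (ρ y).coeff m = Ideal.Quotient.mk 𝔭 ((y : A[T;T⁻¹]).coeff m) :=
    fun y m => by simp [ρ]
  have hker : 𝔭.map (algebraMap A F.extendedRees) ≤ RingHom.ker ρ := by
    refine Ideal.map_le_iff_le_comap.mpr fun a ha => ?_
    rw [Ideal.mem_comap, RingHom.mem_ker]
    apply LaurentPolynomial.ext
    intro m
    rw [hρ]
    change Ideal.Quotient.mk 𝔭 ((C a : A[T;T⁻¹]).coeff m) = 0
    rw [← single_eq_C, AddMonoidAlgebra.coeff_single, Finsupp.single_apply]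
    split_ifs
    · exact Ideal.Quotient.eq_zero_iff_mem.mpr ha
    · rw [map_zero]
  have h := congrArg (fun q : (A ⧸ 𝔭)[T;T⁻¹] => q.coeff m) (RingHom.mem_ker.mp (hker hx))
  simp only [hρ] at h
  exact Ideal.Quotient.eq_zero_iff_mem.mp (by simpa using h)

/-- **The `t⁻¹`-saturation of `𝔭 S` is the set of elements with all coefficients in `𝔭`.**
[cite: Wlodarczyk2022, 3.3.12] -/
theorem mem_iSup_colon_iff_forall_coeff_mem (x : F.extendedRees) :
    x ∈ (⨆ n : ℕ, (𝔭.map (algebraMap A F.extendedRees)).colon ((Ideal.span {𝔰}) ^ n : Ideal _)) ↔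
      ∀ m : ℤ, (x : A[T;T⁻¹]).coeff m ∈ 𝔭 := by
  have hdir : Directed (· ≤ ·) fun n : ℕ =>
      (𝔭.map (algebraMap A F.extendedRees)).colon ((Ideal.span {𝔰}) ^ n : Ideal _) := by
    refine Monotone.directed_le fun m n hmn => Submodule.colon_mono le_rfl ?_
    exact_mod_cast Ideal.pow_le_pow_right hmn
  have hmem : ∀ n : ℕ, x ∈ (𝔭.map (algebraMap A F.extendedRees)).colon ((Ideal.span {𝔰}) ^ n : Ideal _) ↔
      𝔰 ^ n * x ∈ 𝔭.map (algebraMap A F.extendedRees) := by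
    intro n
    rw [Ideal.span_singleton_pow]
    change x ∈ Submodule.colon _ ((Submodule.span (↥F.extendedRees) {𝔰 ^ n} :
      Submodule (↥F.extendedRees) (↥F.extendedRees)) : Set (↥F.extendedRees)) ↔ _
    rw [Submodule.colon_span, Submodule.mem_colon_singleton, smul_eq_mul, mul_comm]
  rw [Submodule.mem_iSup_of_directed _ hdir]
  simp only [hmem]
  constructor
  · rintro ⟨n, hn⟩ m
    have h := F.coeff_mem_of_mem_map 𝔭 hn (m - n)
    rwa [coeff_T_neg_one_pow_mul, sub_add_cancel] at h
  · intro h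
    classical
    obtain ⟨n, hn⟩ : ∃ n : ℕ, ∀ m ∈ (x : A[T;T⁻¹]).coeff.support, m ≤ n := by
      refine ⟨((x : A[T;T⁻¹]).coeff.support.sup Int.toNat), fun m hm => ?_⟩
      exact (Int.self_le_toNat m).trans (by exact_mod_cast Finset.le_sup (f := Int.toNat) hm)
    refine ⟨n, ?_⟩
    -- `sⁿ x = Σ_m c_m s^{n-m}` with `c_m ∈ 𝔭`
    have key : 𝔰 ^ n * x = ∑ m ∈ (x : A[T;T⁻¹]).coeff.support,
        algebraMap A F.extendedRees ((x : A[T;T⁻¹]).coeff m) * 𝔰 ^ (n - m).toNat := by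
      apply Subtype.ext
      rw [MulMemClass.coe_mul, SubmonoidClass.coe_pow]
      conv_lhs => rw [← AddMonoidAlgebra.sum_coeff_single (x : A[T;T⁻¹])]
      rw [Finsupp.sum, Finset.mul_sum, AddSubmonoidClass.coe_finsetSum]
      refine Finset.sum_congr rfl fun m hm => ?_
      rw [MulMemClass.coe_mul, SubmonoidClass.coe_pow, Subalgebra.coe_algebraMap]
      change (T (-1) : A[T;T⁻¹]) ^ n * AddMonoidAlgebra.single m ((x : A[T;T⁻¹]).coeff m) =
        C ((x : A[T;T⁻¹]).coeff m) * (T (-1) : A[T;T⁻¹]) ^ (n - m).toNat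
      rw [single_eq_C_mul_T, T_pow, T_pow, mul_left_comm, ← T_add]
      congr 2
      have := hn m hm
      omega
    rw [key]
    exact Ideal.sum_mem _ fun m _ => Ideal.mul_mem_right _ _ (Ideal.mem_map_of_mem _ (h m))

/-- **The `t⁻¹`-saturation of a prime ideal in the extended Rees algebra is prime**: it is the
kernel of the reduction `S → (A/𝔭)[t, t⁻¹]`, a ring map to a domain. Geometrically: on every chart
the strict transform of an integral closed subscheme under a cobordant blow-up is integral.
[cite: Wlodarczyk2022, 3.3.12] -/
theorem isPrime_iSup_colon [𝔭.IsPrime] :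
    (⨆ n : ℕ, (𝔭.map (algebraMap A F.extendedRees)).colon ((Ideal.span {𝔰}) ^ n : Ideal _)).IsPrime := by
  let ρ : F.extendedRees →+* (A ⧸ 𝔭)[T;T⁻¹] :=
    (AddMonoidAlgebra.mapRingHom ℤ (Ideal.Quotient.mk 𝔭)).comp F.extendedRees.val.toRingHom
  have hρ : ∀ (y : F.extendedRees) (m : ℤ), (ρ y).coeff m = Ideal.Quotient.mk 𝔭 ((y : A[T;T⁻¹]).coeff m) :=
    fun y m => by simp [ρ]
  have heq : (⨆ n : ℕ, (𝔭.map (algebraMap A F.extendedRees)).colon ((Ideal.span {𝔰}) ^ n : Ideal _)) =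
      RingHom.ker ρ := by
    ext x
    rw [mem_iSup_colon_iff_forall_coeff_mem, RingHom.mem_ker]
    constructor
    · intro h
      apply LaurentPolynomial.ext
      intro m
      rw [hρ, Ideal.Quotient.eq_zero_iff_mem.mpr (h m)]
      rfl
    · intro h m
      have := congrArg (fun q : (A ⧸ 𝔭)[T;T⁻¹] => q.coeff m) h
      simp only [hρ] at this
      exact Ideal.Quotient.eq_zero_iff_mem.mp (by simpa using this)
  rw [heq]
  haveI : IsDomain (A ⧸ 𝔭) := Ideal.Quotient.isDomain 𝔭
  exact RingHom.ker_isPrime _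

end IdealFiltration

end Literature.AlgebraicGeometry.Resolution

end
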